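import Literature.Analysis.PDE.FlatNeumann
import HarnessLib

/-!
# The flat fine parametrix: pointwise-in-time energies of the residual, one level up
# (topic `Analysis/PDE`)

Layer (I') of the programme to prove short-time existence for quasilinear strictly parabolic
systems on a closed manifold (hypothesis `hQL` of
`Literature.Geometry.Riemannian.ricciFlow_shortTime_existence_of_quasilinear`). The Neumann
iteration of `FlatNeumann.lean` controls the residual `Θ_N` in the time-integrated weighted norm
`𝒩`; the callers need it POINTWISE in time. This file converts: at every time `s ∈ [0, T]`,

  `E_k(errOne(Θ')(s)) ≤ #ι · Cpush · e^{2λs} (A₀ n² + B₀ (n + λ⁻¹)) · Σ_i ∫₀ˢ e^{-2λσ} E_{k+1}(Θ̃'_i(σ)) dσ`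

(`sobolevEnergy_errOne_le`): the energy of a sum, transport by the inverse adapted affine maps
(`Cpush`), the slice bound of the flat local residual, and the pointwise-in-time heat engine for
the local Duhamel solutions — maximal regularity costs one level (`k + 1` on the data). With
`Θ' = Θ_{N-1}` and the geometric decay of `𝒩_{k+1}` this makes `sup_s E_k(Θ_N(s))` small.

Everything is proved; no named fact and no `sorry` is introduced.

## References

* L. Hörmander, *The Analysis of Linear Partial Differential Operators III*, Springer 1985,
  §17.1. [Hormander1985III]
-/

noncomputable section

open Set Function Filter Topology Metric MeasureTheory InnerProductSpace
open scoped ContDiff Topology ENNReal RealInnerProductSpace Laplacian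

namespace Literature.Analysis.PDE

open Literature.Analysis.FunctionSpaces Literature.Analysis.FluidPDE TopologicalSpace

variable {E' : Type*} [NormedAddCommGroup E'] [InnerProductSpace ℝ E'] [FiniteDimensional ℝ E']
variable {F' : Type*} [NormedAddCommGroup F'] [InnerProductSpace ℝ F']

section Engine

variable [MeasurableSpace E'] [BorelSpace E'] [FiniteDimensional ℝ F'] {T : ℝ}

omit [FiniteDimensional ℝ F'] in
/-- Second-order energies are bounded by first-order energies one level up:
`Σ_{ab} E_k(∂_a∂_b w) ≤ n Σ_b E_{k+1}(∂_b w)`. [folklore] -/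
theorem sum_sum_sobolevEnergy_fderiv_fderiv_le (k : ℕ) (w : E' → F') :
    ∑ a, ∑ l, sobolevEnergy k (fun y ↦ fderiv ℝ (fun z ↦ fderiv ℝ w z (stdOrthonormalBasis ℝ E' l)) y
      (stdOrthonormalBasis ℝ E' a)) ≤
      (Module.finrank ℝ E' : ℝ≥0∞) * ∑ l, sobolevEnergy (k + 1) (fun z ↦ fderiv ℝ w z (stdOrthonormalBasis ℝ E' l)) := by
  calc _ ≤ ∑ _a : Fin (Module.finrank ℝ E'), ∑ l, sobolevEnergy (k + 1) (fun z ↦ fderiv ℝ w z (stdOrthonormalBasis ℝ E' l)) := by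
        refine Finset.sum_le_sum fun a _ ↦ Finset.sum_le_sum fun l _ ↦ ?_
        rw [sobolevEnergy_succ]
        refine le_trans ?_ le_add_self
        exact Finset.single_le_sum (f := fun i ↦ sobolevEnergy k fun y ↦
          fderiv ℝ (fun z ↦ fderiv ℝ w z (stdOrthonormalBasis ℝ E' l)) y (stdOrthonormalBasis ℝ E' i))
          (fun _ _ ↦ bot_le) (Finset.mem_univ a)
    _ = _ := by rw [Finset.sum_const, Finset.card_univ, Fintype.card_fin, nsmul_eq_mul]

/-- **Pointwise-in-time energies of the flat local solution, one level up**: for slab data `Θ`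
with compact support and `s ∈ [0, T]`, `λ > 0`,
`A₀ Σ E_k(∂∂w(s)) + B₀ (Σ E_k(∂w(s)) + E_k(w(s))) ≤ e^{2λs} (A₀ n² + B₀ (n + λ⁻¹)) ∫₀ˢ e^{-2λσ} E_{k+1}(Θ(σ)) dσ`.
[cite: Evans2010, §7.1.3] -/
theorem slice_bound_flatLocalSol_le (hT : 0 < T) {Θ : ℝ → E' → F'} (hΘ : IsSmoothSpaceTimeOn (Icc 0 T) Θ)
    {K : Set E'} (hK : IsCompact K) (hΘK : ∀ s, ∀ z ∉ K, Θ s z = 0) (k : ℕ) (A₀ B₀ : ℝ≥0∞)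
    {lam : ℝ} (hlam : 0 < lam) {s : ℝ} (hs : s ∈ Icc 0 T) :
    A₀ * ∑ a, ∑ l, sobolevEnergy k (fun y ↦ fderiv ℝ (fun z ↦ fderiv ℝ (flatLocalSol T Θ s) z
        (stdOrthonormalBasis ℝ E' l)) y (stdOrthonormalBasis ℝ E' a)) +
      B₀ * (∑ l, sobolevEnergy k (fun z ↦ fderiv ℝ (flatLocalSol T Θ s) z (stdOrthonormalBasis ℝ E' l)) +
        sobolevEnergy k (flatLocalSol T Θ s)) ≤
      ENNReal.ofReal (Real.exp (2 * lam * s)) * (A₀ * ((Module.finrank ℝ E' : ℝ≥0∞) * (Module.finrank ℝ E' : ℝ≥0∞)) +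
          B₀ * ((Module.finrank ℝ E' : ℝ≥0∞) + ENNReal.ofReal lam⁻¹)) *
        ∫⁻ σ in Ioo 0 s, ENNReal.ofReal (Real.exp (-2 * lam * σ)) * sobolevEnergy (k + 1) (Θ σ) := by
  have hext := isSpaceTimeTestOn_slabExtend_of_slab hT hΘ hK hΘK
  set w := flatLocalSol T Θ with hw
  set J : ℝ≥0∞ := ∫⁻ σ in Ioo 0 s, ENNReal.ofReal (Real.exp (-2 * lam * σ)) * sobolevEnergy (k + 1) (Θ σ) with hJ
  have hdata : ∀ i, ∫⁻ σ in Ioo 0 s, ENNReal.ofReal (Real.exp (-2 * lam * σ)) * sobolevEnergy i (slabExtend T Θ σ) =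
      ∫⁻ σ in Ioo 0 s, ENNReal.ofReal (Real.exp (-2 * lam * σ)) * sobolevEnergy i (Θ σ) := fun i ↦ by
    refine setLIntegral_congr_fun measurableSet_Ioo fun σ hσ ↦ ?_
    rw [slabExtend_eq_of_mem ⟨hσ.1.le, hσ.2.le.trans hs.2⟩]
  have hmono : ∫⁻ σ in Ioo 0 s, ENNReal.ofReal (Real.exp (-2 * lam * σ)) * sobolevEnergy k (Θ σ) ≤ J :=
    lintegral_mono fun σ ↦ mul_le_mul' le_rfl (sobolevEnergy_le_succ k _)
  set e : ℝ≥0∞ := ENNReal.ofReal (Real.exp (-2 * lam * s)) with he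
  -- the engine, pointwise in time
  have h2 : e * ∑ l, sobolevEnergy (k + 1) (fun z ↦ fderiv ℝ (w s) z (stdOrthonormalBasis ℝ E' l)) ≤
      (Module.finrank ℝ E' : ℝ≥0∞) * J := by
    have h := weight_mul_sum_sobolevEnergy_fderiv_heatDuhamelZero_le (E := E') (F' := F') one_pos hlam.le (k + 1) hext hs.1
    rw [div_one, ENNReal.ofReal_natCast, hdata] at h
    exact h
  have h1 : e * ∑ l, sobolevEnergy k (fun z ↦ fderiv ℝ (w s) z (stdOrthonormalBasis ℝ E' l)) ≤
      (Module.finrank ℝ E' : ℝ≥0∞) * J := by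
    have h := weight_mul_sum_sobolevEnergy_fderiv_heatDuhamelZero_le (E := E') (F' := F') one_pos hlam.le k hext hs.1
    rw [div_one, ENNReal.ofReal_natCast, hdata] at h
    exact h.trans (mul_le_mul' le_rfl hmono)
  have h0 : e * sobolevEnergy k (w s) ≤ ENNReal.ofReal lam⁻¹ * J := by
    have h := weight_mul_sobolevEnergy_heatDuhamelZero_le (E := E') (F' := F') one_pos hlam k hext hs.1
    rw [hdata] at h
    exact h.trans (mul_le_mul' le_rfl hmono)
  have hX : e * ∑ a, ∑ l, sobolevEnergy k (fun y ↦ fderiv ℝ (fun z ↦ fderiv ℝ (w s) z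
      (stdOrthonormalBasis ℝ E' l)) y (stdOrthonormalBasis ℝ E' a)) ≤
      (Module.finrank ℝ E' : ℝ≥0∞) * ((Module.finrank ℝ E' : ℝ≥0∞) * J) := by
    calc _ ≤ e * ((Module.finrank ℝ E' : ℝ≥0∞) * ∑ l, sobolevEnergy (k + 1) (fun z ↦ fderiv ℝ (w s) z
          (stdOrthonormalBasis ℝ E' l))) := mul_le_mul' le_rfl (sum_sum_sobolevEnergy_fderiv_fderiv_le k (w s))
      _ = (Module.finrank ℝ E' : ℝ≥0∞) * (e * ∑ l, sobolevEnergy (k + 1) (fun z ↦ fderiv ℝ (w s) z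
          (stdOrthonormalBasis ℝ E' l))) := by ring
      _ ≤ _ := mul_le_mul' le_rfl h2
  -- remove the weight: `e⁻¹ = e^{2λs}`
  have hee : ENNReal.ofReal (Real.exp (2 * lam * s)) * e = 1 := by
    rw [he, ← ENNReal.ofReal_mul (Real.exp_pos _).le, ← Real.exp_add]
    norm_num
  have hkey : ∀ {X Y : ℝ≥0∞}, e * X ≤ Y → X ≤ ENNReal.ofReal (Real.exp (2 * lam * s)) * Y := by
    intro X Y h
    calc X = ENNReal.ofReal (Real.exp (2 * lam * s)) * e * X := by rw [hee, one_mul]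
      _ = ENNReal.ofReal (Real.exp (2 * lam * s)) * (e * X) := by ring
      _ ≤ _ := mul_le_mul' le_rfl h
  calc A₀ * ∑ a, ∑ l, sobolevEnergy k (fun y ↦ fderiv ℝ (fun z ↦ fderiv ℝ (w s) z
        (stdOrthonormalBasis ℝ E' l)) y (stdOrthonormalBasis ℝ E' a)) +
        B₀ * (∑ l, sobolevEnergy k (fun z ↦ fderiv ℝ (w s) z (stdOrthonormalBasis ℝ E' l)) + sobolevEnergy k (w s))
      ≤ A₀ * (ENNReal.ofReal (Real.exp (2 * lam * s)) * ((Module.finrank ℝ E' : ℝ≥0∞) * ((Module.finrank ℝ E' : ℝ≥0∞) * J))) +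
        B₀ * (ENNReal.ofReal (Real.exp (2 * lam * s)) * ((Module.finrank ℝ E' : ℝ≥0∞) * J) +
          ENNReal.ofReal (Real.exp (2 * lam * s)) * (ENNReal.ofReal lam⁻¹ * J)) :=
        add_le_add (mul_le_mul' le_rfl (hkey hX)) (mul_le_mul' le_rfl (add_le_add (hkey h1) (hkey h0)))
    _ = _ := by ring

end Engine

namespace FlatStep

variable {ι : Type*} [Fintype ι] (Q : FlatPatches E' ι) (A : ι → E' ≃L[ℝ] E') (T : ℝ)
  (S : ℝ → E' → (E' →L[ℝ] E')) (𝔟 : ℝ → E' → ((E' →L[ℝ] F') →L[ℝ] F')) (𝔠 : ℝ → E' → (F' →L[ℝ] F'))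
  (Θ : ℝ → E' → F') [MeasurableSpace E'] [BorelSpace E'] [FiniteDimensional ℝ F']

omit [FiniteDimensional ℝ E'] [MeasurableSpace E'] [BorelSpace E'] [FiniteDimensional ℝ F'] in
/-- The inverse adapted maps are affine: `Ψ_i⁻¹ y = A_i y + A_i(-c_i)`. [folklore] -/
theorem psiInv_eq_affine (i : ι) (y : E') : psiInv Q A i y = (A i : E' →L[ℝ] E') y + A i (-Q.c i) := by
  simp [psiInv, sub_eq_add_neg, map_add]

omit [FiniteDimensional ℝ E'] [MeasurableSpace E'] [BorelSpace E'] [FiniteDimensional ℝ F'] [Fintype ι] in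
/-- The frames are invertible. [folklore] -/
theorem det_frame_ne_zero (i : ι) : LinearMap.det ((A i : E' →L[ℝ] E') : E' →ₗ[ℝ] E') ≠ 0 :=
  (LinearEquiv.isUnit_det' (A i).toLinearEquiv).ne_zero

/-- **Pointwise-in-time energy of the assembled residual, one level up.** With a slice bound
(constants `A₀, B₀`) for every patch, a bound `Cpush` of the transport constants of the inverse
adapted maps, `λ > 0` and `s ∈ [0, T]`:
`E_k(errOne(s)) ≤ #ι Cpush e^{2λs} (A₀ n² + B₀ (n + λ⁻¹)) Σ_i ∫₀ˢ e^{-2λσ} E_{k+1}(Θ̃_i(σ)) dσ`.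
[cite: Hormander1985III, §17.1] -/
theorem sobolevEnergy_errOne_le (hT : 0 < T) (hΘ : IsSmoothSpaceTimeOn (Icc 0 T) Θ)
    (hS : IsSmoothSpaceTimeOn (Icc 0 T) S) (h𝔟 : IsSmoothSpaceTimeOn (Icc 0 T) 𝔟) (h𝔠 : IsSmoothSpaceTimeOn (Icc 0 T) 𝔠)
    (k : ℕ) {A₀ B₀ Cpush : ℝ≥0∞}
    (hslice : ∀ i, ∀ s ∈ Icc 0 T, sobolevEnergy k (errAd Q A T S 𝔟 𝔠 Θ i s) ≤
      A₀ * ∑ a, ∑ l, sobolevEnergy k (fun y ↦ fderiv ℝ (fun z ↦ fderiv ℝ (wAd Q A T Θ i s) z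
        (stdOrthonormalBasis ℝ E' l)) y (stdOrthonormalBasis ℝ E' a)) +
      B₀ * (∑ l, sobolevEnergy k (fun z ↦ fderiv ℝ (wAd Q A T Θ i s) z (stdOrthonormalBasis ℝ E' l)) +
        sobolevEnergy k (wAd Q A T Θ i s)))
    (hpush : ∀ i, ENNReal.ofReal (max 1 (‖(A i : E' →L[ℝ] E')‖ ^ 2) ^ k *
      |(LinearMap.det ((A i : E' →L[ℝ] E') : E' →ₗ[ℝ] E'))⁻¹|) ≤ Cpush)
    {lam : ℝ} (hlam : 0 < lam) {s : ℝ} (hs : s ∈ Icc 0 T) :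
    sobolevEnergy k (errOne Q A T S 𝔟 𝔠 Θ s) ≤
      (Fintype.card ι : ℝ≥0∞) * Cpush * (ENNReal.ofReal (Real.exp (2 * lam * s)) *
        (A₀ * ((Module.finrank ℝ E' : ℝ≥0∞) * (Module.finrank ℝ E' : ℝ≥0∞)) +
          B₀ * ((Module.finrank ℝ E' : ℝ≥0∞) + ENNReal.ofReal lam⁻¹))) *
        ∑ i, ∫⁻ σ in Ioo 0 s, ENNReal.ofReal (Real.exp (-2 * lam * σ)) * sobolevEnergy (k + 1) (dataAd Q A Θ i σ) := by
  classical
  have herrsl : ∀ i, ContDiff ℝ ∞ (errAd Q A T S 𝔟 𝔠 Θ i s) := fun i ↦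
    (isSmoothSpaceTimeOn_errAd Q A T S 𝔟 𝔠 Θ hT hΘ hS h𝔟 h𝔠 i).contDiff_slice hs
  -- the energy of the sum of the pushed-forward pieces
  have heq : errOne Q A T S 𝔟 𝔠 Θ s = fun y ↦ ∑ i, errAd Q A T S 𝔟 𝔠 Θ i s ((A i : E' →L[ℝ] E') y + A i (-Q.c i)) := by
    funext y
    simp only [errOne, errPiece]
    exact Finset.sum_congr rfl fun i _ ↦ by rw [psiInv_eq_affine]
  rw [heq]
  have hsm : ∀ i, ContDiff ℝ k fun y ↦ errAd Q A T S 𝔟 𝔠 Θ i s ((A i : E' →L[ℝ] E') y + A i (-Q.c i)) := fun i ↦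
    ((herrsl i).comp ((A i : E' →L[ℝ] E').contDiff.add contDiff_const)).of_le (by exact_mod_cast le_top)
  refine (sobolevEnergy_sum_le_card k Finset.univ fun i _ ↦ hsm i).trans ?_
  rw [Finset.card_univ]
  have hterm : ∀ i, sobolevEnergy k (fun y ↦ errAd Q A T S 𝔟 𝔠 Θ i s ((A i : E' →L[ℝ] E') y + A i (-Q.c i))) ≤
      Cpush * (ENNReal.ofReal (Real.exp (2 * lam * s)) * (A₀ * ((Module.finrank ℝ E' : ℝ≥0∞) *
          (Module.finrank ℝ E' : ℝ≥0∞)) + B₀ * ((Module.finrank ℝ E' : ℝ≥0∞) + ENNReal.ofReal lam⁻¹)) *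
        ∫⁻ σ in Ioo 0 s, ENNReal.ofReal (Real.exp (-2 * lam * σ)) * sobolevEnergy (k + 1) (dataAd Q A Θ i σ)) := by
    intro i
    -- transport by the inverse adapted map, slice bound, engine
    calc sobolevEnergy k (fun y ↦ errAd Q A T S 𝔟 𝔠 Θ i s ((A i : E' →L[ℝ] E') y + A i (-Q.c i)))
        ≤ Cpush * sobolevEnergy k (errAd Q A T S 𝔟 𝔠 Θ i s) :=
          (sobolevEnergy_comp_affine_le _ (det_frame_ne_zero A i) _ k (herrsl i)).trans (mul_le_mul' (hpush i) le_rfl)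
      _ ≤ Cpush * (ENNReal.ofReal (Real.exp (2 * lam * s)) * (A₀ * ((Module.finrank ℝ E' : ℝ≥0∞) *
            (Module.finrank ℝ E' : ℝ≥0∞)) + B₀ * ((Module.finrank ℝ E' : ℝ≥0∞) + ENNReal.ofReal lam⁻¹)) *
          ∫⁻ σ in Ioo 0 s, ENNReal.ofReal (Real.exp (-2 * lam * σ)) * sobolevEnergy (k + 1) (dataAd Q A Θ i σ)) :=
            mul_le_mul' le_rfl ((hslice i s hs).trans (slice_bound_flatLocalSol_le hT (isSmoothSpaceTimeOn_dataAd hΘ i)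
              (isCompact_supportAd i) (dataAd_eq_zero i) k A₀ B₀ hlam hs))
  calc (Fintype.card ι : ℝ≥0∞) * ∑ i, sobolevEnergy k (fun y ↦ errAd Q A T S 𝔟 𝔠 Θ i s ((A i : E' →L[ℝ] E') y + A i (-Q.c i)))
      ≤ (Fintype.card ι : ℝ≥0∞) * ∑ i, Cpush * (ENNReal.ofReal (Real.exp (2 * lam * s)) * (A₀ * ((Module.finrank ℝ E' : ℝ≥0∞) *
          (Module.finrank ℝ E' : ℝ≥0∞)) + B₀ * ((Module.finrank ℝ E' : ℝ≥0∞) + ENNReal.ofReal lam⁻¹)) *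
        ∫⁻ σ in Ioo 0 s, ENNReal.ofReal (Real.exp (-2 * lam * σ)) * sobolevEnergy (k + 1) (dataAd Q A Θ i σ)) :=
        mul_le_mul' le_rfl (Finset.sum_le_sum fun i _ ↦ hterm i)
    _ = _ := by rw [← Finset.mul_sum, ← Finset.mul_sum]; ring

omit [FiniteDimensional ℝ F'] in
/-- **A continuous field with vanishing energy vanishes identically.** [folklore] -/
theorem eq_zero_of_sobolevEnergy_eq_zero {f : E' → F'} (hf : Continuous f) {k : ℕ} (h : sobolevEnergy k f = 0) :
    f = fun _ ↦ 0 := by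
  have h0 : ∫⁻ x, ‖f x‖ₑ ^ 2 = 0 := le_antisymm (h ▸ lintegral_sq_le_sobolevEnergy k f) bot_le
  have hae : (fun x ↦ ‖f x‖ₑ ^ 2) =ᵐ[volume] 0 :=
    (lintegral_eq_zero_iff ((continuous_enorm.comp hf).measurable.pow_const 2)).1 h0
  have hae' : f =ᵐ[volume] fun _ ↦ 0 := by
    filter_upwards [hae] with x hx
    have : ‖f x‖ₑ = 0 := by simpa using hx
    simpa using this
  exact (hf.ae_eq_iff_eq volume continuous_const).1 hae'

/-- **Pointwise-in-time energy of the one-step error, counting only the ACTIVE patches.** If the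
adapted data vanish identically (on `[0, T]`) outside a finite set `act` of patches, the factor
`#ι` of `sobolevEnergy_errOne_le` improves to `#act`:
`E_k(errOne(s)) ≤ #act Cpush e^{2λs} (A₀ n² + B₀ (n + λ⁻¹)) Σ_i ∫₀ˢ e^{-2λσ} E_{k+1}(Θ̃_i(σ)) dσ`.
[cite: Hormander1985III, §17.1] -/
theorem sobolevEnergy_errOne_le_active (hT : 0 < T) (hΘ : IsSmoothSpaceTimeOn (Icc 0 T) Θ)
    (hS : IsSmoothSpaceTimeOn (Icc 0 T) S) (h𝔟 : IsSmoothSpaceTimeOn (Icc 0 T) 𝔟) (h𝔠 : IsSmoothSpaceTimeOn (Icc 0 T) 𝔠)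
    (k : ℕ) {A₀ B₀ Cpush : ℝ≥0∞}
    (hslice : ∀ i, ∀ s ∈ Icc 0 T, sobolevEnergy k (errAd Q A T S 𝔟 𝔠 Θ i s) ≤
      A₀ * ∑ a, ∑ l, sobolevEnergy k (fun y ↦ fderiv ℝ (fun z ↦ fderiv ℝ (wAd Q A T Θ i s) z
        (stdOrthonormalBasis ℝ E' l)) y (stdOrthonormalBasis ℝ E' a)) +
      B₀ * (∑ l, sobolevEnergy k (fun z ↦ fderiv ℝ (wAd Q A T Θ i s) z (stdOrthonormalBasis ℝ E' l)) +
        sobolevEnergy k (wAd Q A T Θ i s)))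
    (hpush : ∀ i, ENNReal.ofReal (max 1 (‖(A i : E' →L[ℝ] E')‖ ^ 2) ^ k *
      |(LinearMap.det ((A i : E' →L[ℝ] E') : E' →ₗ[ℝ] E'))⁻¹|) ≤ Cpush)
    (act : Finset ι) (hact : ∀ i ∉ act, ∀ σ ∈ Icc 0 T, dataAd Q A Θ i σ = fun _ ↦ 0)
    {lam : ℝ} (hlam : 0 < lam) {s : ℝ} (hs : s ∈ Icc 0 T) :
    sobolevEnergy k (errOne Q A T S 𝔟 𝔠 Θ s) ≤
      (act.card : ℝ≥0∞) * Cpush * (ENNReal.ofReal (Real.exp (2 * lam * s)) *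
        (A₀ * ((Module.finrank ℝ E' : ℝ≥0∞) * (Module.finrank ℝ E' : ℝ≥0∞)) +
          B₀ * ((Module.finrank ℝ E' : ℝ≥0∞) + ENNReal.ofReal lam⁻¹))) *
        ∑ i, ∫⁻ σ in Ioo 0 s, ENNReal.ofReal (Real.exp (-2 * lam * σ)) * sobolevEnergy (k + 1) (dataAd Q A Θ i σ) := by
  classical
  have herrsl : ∀ i, ContDiff ℝ ∞ (errAd Q A T S 𝔟 𝔠 Θ i s) := fun i ↦
    (isSmoothSpaceTimeOn_errAd Q A T S 𝔟 𝔠 Θ hT hΘ hS h𝔟 h𝔠 i).contDiff_slice hs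
  -- the per-patch bound (transport, slice bound, engine)
  have hterm : ∀ i, sobolevEnergy k (fun y ↦ errAd Q A T S 𝔟 𝔠 Θ i s ((A i : E' →L[ℝ] E') y + A i (-Q.c i))) ≤
      Cpush * (ENNReal.ofReal (Real.exp (2 * lam * s)) * (A₀ * ((Module.finrank ℝ E' : ℝ≥0∞) *
          (Module.finrank ℝ E' : ℝ≥0∞)) + B₀ * ((Module.finrank ℝ E' : ℝ≥0∞) + ENNReal.ofReal lam⁻¹)) *
        ∫⁻ σ in Ioo 0 s, ENNReal.ofReal (Real.exp (-2 * lam * σ)) * sobolevEnergy (k + 1) (dataAd Q A Θ i σ)) := by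
    intro i
    calc sobolevEnergy k (fun y ↦ errAd Q A T S 𝔟 𝔠 Θ i s ((A i : E' →L[ℝ] E') y + A i (-Q.c i)))
        ≤ Cpush * sobolevEnergy k (errAd Q A T S 𝔟 𝔠 Θ i s) :=
          (sobolevEnergy_comp_affine_le _ (det_frame_ne_zero A i) _ k (herrsl i)).trans (mul_le_mul' (hpush i) le_rfl)
      _ ≤ _ := mul_le_mul' le_rfl ((hslice i s hs).trans (slice_bound_flatLocalSol_le hT (isSmoothSpaceTimeOn_dataAd hΘ i)
              (isCompact_supportAd i) (dataAd_eq_zero i) k A₀ B₀ hlam hs))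
  -- inactive patches: the energy bound vanishes, hence the (continuous) piece vanishes
  have hzero : ∀ i ∉ act, (fun y ↦ errAd Q A T S 𝔟 𝔠 Θ i s ((A i : E' →L[ℝ] E') y + A i (-Q.c i))) = fun _ ↦ 0 := by
    intro i hi
    have hint : (∫⁻ σ in Ioo 0 s, ENNReal.ofReal (Real.exp (-2 * lam * σ)) * sobolevEnergy (k + 1) (dataAd Q A Θ i σ)) = 0 := by
      rw [setLIntegral_congr_fun measurableSet_Ioo (g := fun _ ↦ 0) fun σ hσ ↦ by
        rw [hact i hi σ ⟨hσ.1.le, hσ.2.le.trans hs.2⟩, sobolevEnergy_zero_fun, mul_zero]]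
      exact lintegral_zero
    have hE : sobolevEnergy k (fun y ↦ errAd Q A T S 𝔟 𝔠 Θ i s ((A i : E' →L[ℝ] E') y + A i (-Q.c i))) = 0 := by
      have h := hterm i
      rw [hint, mul_zero, mul_zero] at h
      exact le_antisymm h bot_le
    exact eq_zero_of_sobolevEnergy_eq_zero (((herrsl i).continuous).comp
      (((A i : E' →L[ℝ] E').continuous).add continuous_const)) hE
  -- the error is the sum of the active pieces
  have heq : errOne Q A T S 𝔟 𝔠 Θ s = fun y ↦ ∑ i ∈ act, errAd Q A T S 𝔟 𝔠 Θ i s ((A i : E' →L[ℝ] E') y + A i (-Q.c i)) := by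
    funext y
    have h1 : errOne Q A T S 𝔟 𝔠 Θ s y = ∑ i, errAd Q A T S 𝔟 𝔠 Θ i s ((A i : E' →L[ℝ] E') y + A i (-Q.c i)) := by
      simp only [errOne, errPiece]
      exact Finset.sum_congr rfl fun i _ ↦ by rw [psiInv_eq_affine]
    rw [h1]
    refine (Finset.sum_subset (Finset.subset_univ act) fun i _ hi ↦ ?_).symm
    exact congrFun (hzero i hi) y
  rw [heq]
  have hsm : ∀ i ∈ act, ContDiff ℝ k fun y ↦ errAd Q A T S 𝔟 𝔠 Θ i s ((A i : E' →L[ℝ] E') y + A i (-Q.c i)) := fun i _ ↦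
    ((herrsl i).comp ((A i : E' →L[ℝ] E').contDiff.add contDiff_const)).of_le (by exact_mod_cast le_top)
  refine (sobolevEnergy_sum_le_card k act hsm).trans ?_
  calc (act.card : ℝ≥0∞) * ∑ i ∈ act, sobolevEnergy k (fun y ↦ errAd Q A T S 𝔟 𝔠 Θ i s ((A i : E' →L[ℝ] E') y + A i (-Q.c i)))
      ≤ (act.card : ℝ≥0∞) * ∑ i, Cpush * (ENNReal.ofReal (Real.exp (2 * lam * s)) * (A₀ * ((Module.finrank ℝ E' : ℝ≥0∞) *
          (Module.finrank ℝ E' : ℝ≥0∞)) + B₀ * ((Module.finrank ℝ E' : ℝ≥0∞) + ENNReal.ofReal lam⁻¹)) *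
        ∫⁻ σ in Ioo 0 s, ENNReal.ofReal (Real.exp (-2 * lam * σ)) * sobolevEnergy (k + 1) (dataAd Q A Θ i σ)) :=
        mul_le_mul' le_rfl ((Finset.sum_le_sum fun i _ ↦ hterm i).trans
          (Finset.sum_le_sum_of_subset (Finset.subset_univ act)))
    _ = _ := by rw [← Finset.mul_sum, ← Finset.mul_sum]; ring

end FlatStep

end Literature.Analysis.PDE

end
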